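import Summits.QuantumAdvantage.QuantumAdvantage.Theorems.CubicForrelationNearExactIsExactTwelveOddWeightR2
import Summits.QuantumAdvantage.QuantumAdvantage.Theorems.CubicForrelationNearExactIsExactTwelveOddWeightR4Frame

/-!
# Crux `CubicForrelation.NearExactIsExact` (stmt-QuantumAdvantage-14043) — n = 12, WEIGHT OF A TYPE-O CUBIC, VI: CELL bookkeeping for case R4
  (affine functions as shifted parities, 4-bit labels, masks, and small decidable facts about `𝔽₂⁴`)

Certificate seat `b2b-cforr-cert` (gen 32).  HONEST FRAMING: elementary bookkeeping lemmas (standard axioms) used by …TwelveOddWeightR4 to feed the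
arithmetic core `tow_r4_arith`; NOT summit progress, no value of `θ₁₂`.

* `tow_affine_bits`: an affine Boolean function is `x ↦ b ⊕ ⟨x,c⟩`.
* `tow_parity_bxor_right`, `tow_parity_smul_right`: parity is additive / homogeneous in the form.
* `tow_label_*`: the 4-bit label `Σ 2ʲ[pⱼ]` of four bits, its `testBit`s, and equality of labels through bits.
* `tow_mask_parity`: `⊕_{j ∈ m} (bⱼ ⊕ ⟨x,cⱼ⟩) = B_m ⊕ ⟨x, w_m⟩` for the mask combination `w_m = ⊕_{j∈m} cⱼ`.
* `tow_mask_count4`: for masks `0 < m₁ < m₂ < 16` and bits `c₁,c₂` exactly four labels `k < 16` have `m₁·k = c₁`, `m₂·k = c₂`; `tow_pi_count6`: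
  exactly six labels have `k₀k₁ ⊕ k₂k₃ = 1` (both by `decide`).

References: F. J. MacWilliams, N. J. A. Sloane (1977) Ch. 13–15 (notation only).  Axioms: the standard three.
-/

set_option linter.dupNamespace false -- D-0017: single-problem summit ⇒ `QuantumAdvantage.QuantumAdvantage` by design

noncomputable section

namespace Summit.QuantumAdvantage.QuantumAdvantage.Theorems.CubicForrelation.NearExactIsExact

open Finset
open Literature.Computability.QuantumComplexity
open Literature.Computability.QuantumComplexity.BuzetChailloux (bxor zeroVec bxor_bxor_cancel_left bxor_zeroVec zeroVec_bxor bxor_comm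
  bxor_self twist_bxor_right twist_zeroVec_right sum_twist_left bxor_eq_zeroVec_iff)
open Literature.Computability.QuantumComplexity.DerivativeWalsh (W twist_bxor_left)

/-! ### Affine functions and parities -/

/-- **Affine functions are shifted parities**: `φ` of degree `≤ 1` is `x ↦ b ⊕ ⟨x,c⟩`. [cite: Carlet2020, §2.2] -/
theorem tow_affine_bits {n : ℕ} (φ : (Fin n → Bool) → Bool) (hφ : IsDegLeFun 1 φ) :
    ∃ (c : Fin n → Bool) (b : Bool), ∀ x, φ x = (b ^^ decide (Odd #(univ.filter fun j => x j && c j))) := by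
  obtain ⟨c, b, h⟩ := stub_affineForm n φ hφ
  refine ⟨c, b, fun x => ?_⟩
  have hx := h x
  rw [vg_twist_eq_signOf, tow_parity_comm c x, ← signOf_xor] at hx
  revert hx
  cases φ x <;> cases b <;> cases decide (Odd #(univ.filter fun j => x j && c j)) <;> norm_num [signOf]

/-- Parity is additive in the form: `⟨x, u ⊕ v⟩ = ⟨x,u⟩ ⊕ ⟨x,v⟩`. [folklore] -/
theorem tow_parity_bxor_right {n : ℕ} (x u v : Fin n → Bool) :
    decide (Odd #(univ.filter fun j => x j && bxor u v j)) =
      (decide (Odd #(univ.filter fun j => x j && u j)) ^^ decide (Odd #(univ.filter fun j => x j && v j))) := by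
  rw [tow_parity_comm x (bxor u v), tow_parity_bxor, tow_parity_comm u x, tow_parity_comm v x]

/-- Parity against a bit multiple: `⟨x, β·u⟩ = β ∧ ⟨x,u⟩`. [folklore] -/
theorem tow_parity_smul_right {n : ℕ} (x u : Fin n → Bool) (β : Bool) :
    decide (Odd #(univ.filter fun j => x j && (β && u j))) = (β && decide (Odd #(univ.filter fun j => x j && u j))) := by
  cases β
  · simp
  · simp only [Bool.true_and]

/-! ### Four-bit labels -/

/-- The label of four bits is `< 16` and its bits are the given ones. [folklore] -/
theorem tow_label_bits (p₀ p₁ p₂ p₃ : Bool) :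
    ((if p₀ then 1 else 0) + (if p₁ then 2 else 0) + (if p₂ then 4 else 0) + (if p₃ then 8 else 0) : ℕ) < 16 ∧
    Nat.testBit ((if p₀ then 1 else 0) + (if p₁ then 2 else 0) + (if p₂ then 4 else 0) + (if p₃ then 8 else 0) : ℕ) 0 = p₀ ∧
    Nat.testBit ((if p₀ then 1 else 0) + (if p₁ then 2 else 0) + (if p₂ then 4 else 0) + (if p₃ then 8 else 0) : ℕ) 1 = p₁ ∧
    Nat.testBit ((if p₀ then 1 else 0) + (if p₁ then 2 else 0) + (if p₂ then 4 else 0) + (if p₃ then 8 else 0) : ℕ) 2 = p₂ ∧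
    Nat.testBit ((if p₀ then 1 else 0) + (if p₁ then 2 else 0) + (if p₂ then 4 else 0) + (if p₃ then 8 else 0) : ℕ) 3 = p₃ := by
  cases p₀ <;> cases p₁ <;> cases p₂ <;> cases p₃ <;> decide

/-- Two numbers below `16` with the same four low bits are equal. [folklore] -/
theorem tow_eq_of_bits {a b : ℕ} (ha : a < 16) (hb : b < 16) (h0 : Nat.testBit a 0 = Nat.testBit b 0) (h1 : Nat.testBit a 1 = Nat.testBit b 1)
    (h2 : Nat.testBit a 2 = Nat.testBit b 2) (h3 : Nat.testBit a 3 = Nat.testBit b 3) : a = b := by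
  refine Nat.eq_of_testBit_eq fun i => ?_
  rcases Nat.lt_or_ge i 4 with hi | hi
  · interval_cases i
    · exact h0
    · exact h1
    · exact h2
    · exact h3
  · have h2i : 16 ≤ 2 ^ i := by
      calc (16 : ℕ) = 2 ^ 4 := by norm_num
        _ ≤ 2 ^ i := Nat.pow_le_pow_right (by norm_num) hi
    rw [Nat.testBit_eq_false_of_lt (lt_of_lt_of_le ha h2i), Nat.testBit_eq_false_of_lt (lt_of_lt_of_le hb h2i)]

/-! ### Masks -/

/-- The Boolean identity behind `tow_mask_parity`. [folklore] -/
theorem tow_bool_mask : ∀ (m₀ m₁ m₂ m₃ b₀ b₁ b₂ b₃ P₀ P₁ P₂ P₃ : Bool),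
    ((m₀ && (b₀ ^^ P₀)) ^^ (m₁ && (b₁ ^^ P₁)) ^^ (m₂ && (b₂ ^^ P₂)) ^^ (m₃ && (b₃ ^^ P₃))) =
      (((m₀ && b₀) ^^ (m₁ && b₁) ^^ (m₂ && b₂) ^^ (m₃ && b₃)) ^^ ((m₀ && P₀) ^^ (m₁ && P₁) ^^ (m₂ && P₂) ^^ (m₃ && P₃))) := by
  decide

/-- **Mask parity.**  `⊕_{j : mⱼ} (bⱼ ⊕ ⟨x,cⱼ⟩) = (⊕_{j : mⱼ} bⱼ) ⊕ ⟨x, ⊕_{j : mⱼ} cⱼ⟩` for four bits `m₀,…,m₃`. [folklore] -/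
theorem tow_mask_parity {n : ℕ} (x : Fin n → Bool) (c₀ c₁ c₂ c₃ : Fin n → Bool) (b₀ b₁ b₂ b₃ m₀ m₁ m₂ m₃ : Bool) :
    ((m₀ && (b₀ ^^ decide (Odd #(univ.filter fun j => x j && c₀ j)))) ^^ (m₁ && (b₁ ^^ decide (Odd #(univ.filter fun j => x j && c₁ j)))) ^^
      (m₂ && (b₂ ^^ decide (Odd #(univ.filter fun j => x j && c₂ j)))) ^^ (m₃ && (b₃ ^^ decide (Odd #(univ.filter fun j => x j && c₃ j))))) =
    (((m₀ && b₀) ^^ (m₁ && b₁) ^^ (m₂ && b₂) ^^ (m₃ && b₃)) ^^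
      decide (Odd #(univ.filter fun j => x j && ((m₀ && c₀ j) ^^ (m₁ && c₁ j) ^^ (m₂ && c₂ j) ^^ (m₃ && c₃ j))))) := by
  have hc' : decide (Odd #(univ.filter fun j => x j &&
      bxor (bxor (bxor (fun j => m₀ && c₀ j) (fun j => m₁ && c₁ j)) (fun j => m₂ && c₂ j)) (fun j => m₃ && c₃ j) j)) =
      ((m₀ && decide (Odd #(univ.filter fun j => x j && c₀ j))) ^^ (m₁ && decide (Odd #(univ.filter fun j => x j && c₁ j))) ^^
        (m₂ && decide (Odd #(univ.filter fun j => x j && c₂ j))) ^^ (m₃ && decide (Odd #(univ.filter fun j => x j && c₃ j)))) := by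
    rw [tow_parity_bxor_right, tow_parity_bxor_right, tow_parity_bxor_right, tow_parity_smul_right, tow_parity_smul_right,
      tow_parity_smul_right, tow_parity_smul_right]
  have hc : decide (Odd #(univ.filter fun j => x j && ((m₀ && c₀ j) ^^ (m₁ && c₁ j) ^^ (m₂ && c₂ j) ^^ (m₃ && c₃ j)))) =
      ((m₀ && decide (Odd #(univ.filter fun j => x j && c₀ j))) ^^ (m₁ && decide (Odd #(univ.filter fun j => x j && c₁ j))) ^^
        (m₂ && decide (Odd #(univ.filter fun j => x j && c₂ j))) ^^ (m₃ && decide (Odd #(univ.filter fun j => x j && c₃ j)))) := hc'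
  rw [hc]
  exact tow_bool_mask m₀ m₁ m₂ m₃ b₀ b₁ b₂ b₃ _ _ _ _

/-- **Four labels per 9-flat.**  For masks `0 < m₁ < m₂ < 16` and bits `c₁, c₂`, exactly four `k < 16` satisfy `m₁·k = c₁` and `m₂·k = c₂`. [folklore] -/
theorem tow_mask_count4 : ∀ m₁ < 16, ∀ m₂ < 16, 0 < m₁ → m₁ < m₂ → ∀ c₁ c₂ : Bool,
    #((range 16).filter fun k =>
      ((Nat.testBit m₁ 0 && Nat.testBit k 0) ^^ (Nat.testBit m₁ 1 && Nat.testBit k 1) ^^ (Nat.testBit m₁ 2 && Nat.testBit k 2) ^^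
          (Nat.testBit m₁ 3 && Nat.testBit k 3)) = c₁ ∧
        ((Nat.testBit m₂ 0 && Nat.testBit k 0) ^^ (Nat.testBit m₂ 1 && Nat.testBit k 1) ^^ (Nat.testBit m₂ 2 && Nat.testBit k 2) ^^
          (Nat.testBit m₂ 3 && Nat.testBit k 3)) = c₂) = 4 := by
  decide

/-- **Six labels with `k₀k₁ ⊕ k₂k₃ = 1`** (and ten with `0`). [folklore] -/
theorem tow_pi_count6 :
    #((range 16).filter fun k => ((Nat.testBit k 0 && Nat.testBit k 1) ^^ (Nat.testBit k 2 && Nat.testBit k 3)) = true) = 6 ∧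
    #((range 16).filter fun k => ((Nat.testBit k 0 && Nat.testBit k 1) ^^ (Nat.testBit k 2 && Nat.testBit k 3)) = false) = 10 := by
  decide

end Summit.QuantumAdvantage.QuantumAdvantage.Theorems.CubicForrelation.NearExactIsExact

end
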